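import Summits.ResolutionOfSingularities.ResolutionOfSingularities.Theorems.FrobeniusClosingPatchingRelPerfectAtomicRoofEnginePhase
import Literature.AlgebraicGeometry.Resolution.ProperModelsPatching
import Literature.AlgebraicGeometry.Resolution.ProperModelsModification
import Literature.AlgebraicGeometry.Resolution.RegularCentreBlowupSeqExtension
import HarnessLib

/-!
# Crux `PatchingRelPerfect` (stmt-ResolutionOfSingularities-16161), line `closed-point-slice` v5:
# Piltant's TWO-MODEL PATCHING from local desingularizations (kill test K5.2: "which two models")

Route `ResolutionOfSingularities/FrobeniusClosing`, crux #6 `PatchingRelPerfect`; sibling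
`IndSmooth.PatchingPerfect` (stmt-ResolutionOfSingularities-16089), whose open content is exactly
Piltant's two-model patching `ProperModel.TwoModelPatching p` (the tree proves
`resolutionOverUpToDim_of_twoModelPatching_of_relLU`). [OURS · L1 W5.2] This file answers the
slot's kill-test question K5.2 ("is the dimension-`≥ 4` obstruction a missing THEOREM or a missing
DEFINITION — which two models?") in kernel terms: for ANY two proper models `M₁, M₂` of `K/k`,
the dominating model `N` with `φᵢ⁻¹(Reg Mᵢ) ⊆ Reg N` is obtained from the JOIN `J(M₁, M₂)` by
TWO ROOF PHASES of the atomic roof engine (`Theorems.roofPhase`, p462746) — provided the regular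
local rings of `M₁` and `M₂` carry LOCAL DESINGULARIZATIONS (Temkin 2008, Def. 2.2.6: every
integral `T` proper and birational over `Spec 𝒪_{Mᵢ,y}`, regular off the closed fibre, is made
regular by one blowing up with centre in `Sing T`). So two-model patching in characteristic `p` is
a theorem MODULO a LOCAL statement; the missing object in dimension `≥ 4` is that local theorem
(Cossart–Piltant Thm. 1.1 (ii) + Prop. 4.4 one dimension up), not a definition.

## Sources

* O. Piltant, *An axiomatic version of Zariski's patching theorem*, RACSAM 107 (2013) 91–121,
  Prop. 5.1 (`P = P_reg`) and p. 2 (open in dimension `≥ 4`). [Piltant2013]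
* M. Temkin, *Desingularization of quasi-excellent schemes in characteristic zero*, Adv. Math.
  219 (2008) 488–522, Def. 2.2.6, Prop. 2.3.4. [Temkin2008]
* O. Zariski, P. Samuel, *Commutative Algebra* II, Ch. VI §17 (joins of models). [ZariskiSamuel1960]
-/

set_option linter.dupNamespace false -- single-problem summit: doubled namespace component is forced

noncomputable section

open CategoryTheory CategoryTheory.Limits AlgebraicGeometry Literature.AlgebraicGeometry.Resolution
open TopologicalSpace IsLocalRing

namespace Summit.ResolutionOfSingularities.ResolutionOfSingularities.Theorems

/-- **Piltant's two-model patching in characteristic `p` from LOCAL DESINGULARIZATIONS over the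
regular local rings of proper varieties.** If for every field `k` of characteristic `p`, every
integral proper `k`-scheme `N` and every regular point `y ∈ N`, every integral `T` proper and
birational over `Spec 𝒪_{N,y}` and regular off the closed fibre admits a desingularization, then
`ProperModel.TwoModelPatching p` holds: for proper models `M₁, M₂` of `K/k` run the roof phase
(`roofPhase`) of the join `J = J(M₁, M₂)` for the roof `J → M₁`, then for `J → M₂` on the result;
the composite `X₂ → J` is proper birational with `X₂` integral, every singular point of `X₂` lies
over `Sing M₁` and over `Sing M₂`, and `X₂` is a proper model dominating `J`
(`ProperModel.exists_properModel_of_isBirational`). CONDITIONAL on the local hypothesis (open in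
local dimension `≥ 4`). [cite: Piltant2013, Prop. 5.1; Temkin2008, Prop. 2.3.4 and Def. 2.2.6] -/
theorem twoModelPatching_of_localDesing (p : ℕ)
    (hA : ∀ (k : Type) [Field k] [CharP k p] (N : Scheme.{0}) (gN : N ⟶ Spec (.of k))
      [IsProper gN] [IsIntegral N] (y : N), IsRegularLocalRing (N.presheaf.stalk y) →
      ∀ (T : Scheme.{0}) (h : T ⟶ Spec (N.presheaf.stalk y)), IsIntegral T → IsProper h →
        IsBirational h →
        (∀ t : T, h.base t ≠ IsLocalRing.closedPoint (N.presheaf.stalk y) →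
          IsRegularLocalRing (T.presheaf.stalk t)) →
        Scheme.AdmitsDesingularization T) :
    ProperModel.TwoModelPatching.{0} p := by
  intro k _ _ K _ _ _ M₁ M₂
  let J : ProperModel k K := ProperModel.join M₁ M₂
  let ψ₁ : J.Hom M₁ := ProperModel.joinFst M₁ M₂
  let ψ₂ : J.Hom M₂ := ProperModel.joinSnd M₁ M₂
  have hηJ : genericPoint J.X ∈ Scheme.regularLocus J.X := genericPoint_mem_regularLocus J.X
  -- phase 1: the roof `J → M₁`, on the identity of `J`
  obtain ⟨X₁, f₁, J₁, hf₁, hJ₁, h₁⟩ :=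
    roofPhase M₁.π ψ₁.f ψ₁.isBirational (fun y hy => hA k M₁.X M₁.π y hy) (𝟙 J.X)
      (isBirational_id J.X)
  have hne₁ : J₁ ≠ ⊥ := by
    rintro rfl
    have : genericPoint J.X ∈ ((⊥ : J.X.IdealSheafData).support : Set J.X) := by
      rw [Scheme.IdealSheafData.support_bot]; trivial
    exact hJ₁ this hηJ
  haveI : IsIntegral X₁ := hf₁.isIntegral hne₁
  haveI : IsProper f₁ := hf₁.isProper
  have hf₁bir : IsBirational f₁ := hf₁.isBirational' hne₁
  haveI : IsNoetherian X₁ := Scheme.isNoetherian_of_finiteType_over_field (f₁ ≫ J.π)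
  -- phase 2: the roof `J → M₂`, on `X₁ → J`
  obtain ⟨X₂, g₂, J₂, hg₂, hJ₂, h₂⟩ :=
    roofPhase M₂.π ψ₂.f ψ₂.isBirational (fun y hy => hA k M₂.X M₂.π y hy) f₁ hf₁bir
  have hηX₁ : genericPoint X₁ ∈ Scheme.regularLocus X₁ := genericPoint_mem_regularLocus X₁
  have hne₂ : J₂ ≠ ⊥ := by
    rintro rfl
    have : genericPoint X₁ ∈ ((⊥ : X₁.IdealSheafData).support : Set X₁) := by
      rw [Scheme.IdealSheafData.support_bot]; trivial
    exact hJ₂ this hηX₁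
  haveI : IsIntegral X₂ := hg₂.isIntegral hne₂
  haveI : IsProper g₂ := hg₂.isProper
  have hρbir : IsBirational (g₂ ≫ f₁) := (hg₂.isBirational' hne₂).comp hf₁bir
  -- `X₂` is a proper model `N` dominating `J`
  obtain ⟨N, φ, e, hφ⟩ := J.exists_properModel_of_isBirational (g₂ ≫ f₁) hρbir
  subst e
  simp only [eqToHom_refl, Category.id_comp] at hφ
  refine ⟨N, φ.comp ψ₁, φ.comp ψ₂, fun y hy => ?_, fun y hy => ?_⟩
  · -- `(φ ≫ ψ₁)⁻¹(Reg M₁) ⊆ Reg N`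
    rw [ProperModel.Hom.comp_f, hφ, Scheme.Hom.comp_apply, Scheme.Hom.comp_apply] at hy
    by_contra hs
    have hs' : y ∉ Scheme.regularLocus N.X := fun h => hs ((Scheme.mem_regularLocus y).mp h)
    have h2 := (h₂ y hs').1
    have h1 := (h₁ (g₂ y) h2).2
    apply h1
    exact (Scheme.mem_regularLocus _).mpr hy
  · -- `(φ ≫ ψ₂)⁻¹(Reg M₂) ⊆ Reg N`
    rw [ProperModel.Hom.comp_f, hφ, Scheme.Hom.comp_apply, Scheme.Hom.comp_apply] at hy
    by_contra hs
    have hs' : y ∉ Scheme.regularLocus N.X := fun h => hs ((Scheme.mem_regularLocus y).mp h)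
    have h2 := (h₂ y hs').2
    apply h2
    exact (Scheme.mem_regularLocus _).mpr hy

end Summit.ResolutionOfSingularities.ResolutionOfSingularities.Theorems

end
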